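import Summits.QuantumFields.YangMills.Theorems.BalabanUVNodesN13UVChiOffSolvableAtRecord13
import Literature.MathematicalPhysics.QuantumFieldTheory.BalabanImbrieJaffe1984to88.BIJ85CurlQsstar
import Literature.MathematicalPhysics.QuantumFieldTheory.Balaban1983to89.B12SmallFieldDomain259
import Literature.MathematicalPhysics.QuantumFieldTheory.Balaban1983to89.BlockAveragingSU2
import Summits.QuantumFields.YangMills.Theorems.ConvexGribovBodyBrascampLiebVacuumSCDimensionGapSU2

/-!
# BalabanUVNodes ∕ N13 — NON-VACUITY OF THE LARGE-FIELD LOCUS OF p593634: plaquettes INSIDE a block are `b₀`-free, and every group element is the plaquette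
# variable of a configuration at such a plaquette; so §3's antecedent «a b₀-free plaquette with |U(∂p) − 1| ≥ 2εreg + 4ε₂₉» is inhabited as soon as SOME
# `g₀ ∈ SU(N)` has `dist1 g₀ ≥ 2εreg + 4ε₂₉` (e.g. `N ≥ 2`, small thresholds) — the A6 label of p593634's FILED line, discharged modulo that group numeral

Cell `pub-ymgap` (HUMAN RULING D-0062 Track A; D-0149 width seat `pub-ymgap-dag-n13-w1`, g2, INTENT-4), key K1⁷ `StabilityBAtRecordR13SepCoPH` = stmt-QuantumFields-20542
(`--kind proof --supports … --as helper`).  [I] = [Balaban1987RG1].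

WHAT THIS FILE PROVES (theorems only, 0 `def`).
* §1 `not_isB0_of_blockOf_src_eq` — a bond of `T^{(k)}` whose two end points lie in the SAME `(k+1)`-block is not a distinguished bond `b₀(c)` ([I] p. 267: `b₀(c)` is the middle
  bond of the corridor of `c`, its end points lie in the two DIFFERENT blocks `B(c₋)`, `B(c₊)` — lit-balaban's `B12SmallFieldDomain259.b0_mem_corridor`, `src_ne_tgt`).
* §2 `plaquette_offB0_of_interior` — the plaquette at a block site `blockSite y r` with offsets `r_μ + 1 < L`, `r_ν + 1 < L` has all four bonds `b₀`-free (its four corners stay in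
  `B(y)`, `BIJ85CurlQsstar.shift_blockSite_of_lt`); `plaquette_offB0_centre` — in particular the plaquette at a block CENTRE `emb y` (`L ≥ 3`).
* §3 `plaqHol_singleBond` — the configuration equal to `g₀` on the first bond of a plaquette and `1` elsewhere has plaquette variable `g₀`; ★ `exists_offB0_plaquette_plaqHol_eq` —
  for every `g₀ : SU(N)` there are `U`, `p` with `p` `b₀`-free and `U(∂p) = g₀`; ★ `exists_offB0_largePlaquette_of_le_dist1` — hence p593634 §3's antecedent is INHABITED whenever
  `2εreg + 4ε₂₉ ≤ dist1 g₀` for some `g₀` (displayed group numeral; for `N = 1` the group is trivial and the locus is empty, as it should be).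
* §4 `dist1_neg_one_SU2` (`dist1 (−1) = 2` in `SU(2)`, chord formula of `SU2ChordGeometry`; `−1 ∈ SU(2)` = the landed `DimensionGapSU2.neg_one_mem`) and ★ `exists_offB0_largePlaquette_SU2`: at the group of record `N = 2` the locus is inhabited
  whenever `2εreg + 4ε₂₉ ≤ 2` — unconditional non-vacuity of p593634 §3 ∕ §6 in the regime of record.

HONEST FRAMING.  Count-neutral lattice∕group bookkeeping; nothing of Bałaban's asserted; N13 NOT discharged; K0⁷∕K1⁷ NOT closed; counts unmoved (5∕27 · A 5∕28); one finite
`𝕋⁴_{L^K}` programme at fixed `ε = L^{−K}` — R4 closes the conditional finite-𝕋⁴ rung `BalabanLadder.UV` only; the YM mass gap (Clay) is NOT proved by any of this.  No `def`,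
no `sorry`, no `instance`.
-/

noncomputable section

open scoped Matrix.Norms.L2Operator

namespace Summit.QuantumFields.YangMills.BalabanUVNodes.N13OffB0PlaquetteWitness

open Literature.MathematicalPhysics.QuantumFieldTheory.Balaban1983to89
open Literature.MathematicalPhysics.QuantumFieldTheory.Balaban1983to89.T4Continuum (T4Family)
open Literature.MathematicalPhysics.QuantumFieldTheory.Balaban1983to89.Node00
open Literature.MathematicalPhysics.QuantumFieldTheory.BalabanImbrieJaffe1984to88.BIJ85CurlQsstar (shift_blockSite_of_lt)
open B12SmallFieldDomain259 (b0 b0_mem_corridor src_ne_tgt)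

variable {F : T4Family} {N : ℕ} [NeZero N] {K k : ℕ}

/-! ## §1 A bond inside one block is not a distinguished bond -/

/-- **A bond of `T^{(k)}` whose end points lie in the same `(k+1)`-block is not a `b₀(c)`** (standing range `k + 1 ≤ m + K`): the end points of `b₀(c)` lie in `B(c₋)` and `B(c₊)`,
and `c₋ ≠ c₊`. [cite: Balaban1987RG1, p.267] -/
theorem not_isB0_of_blockOf_src_eq (hk : k + 1 ≤ (F.P K).m + (F.P K).K) (b : PBond (F.P K) k) (h : blockOf b.src = blockOf b.tgt) : ¬ IsB0 (F := F) b := by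
  rintro ⟨c, rfl⟩
  have hc := b0_mem_corridor hk c
  exact src_ne_tgt c (hc.1.symm.trans (h.trans hc.2))

/-! ## §2 Plaquettes inside a block are `b₀`-free -/

section Interior

variable (hk : k + 1 ≤ (F.P K).m + (F.P K).K) (y : Site (F.P K) (k + 1)) (r : Fin (F.P K).d → Fin (F.P K).L)
  {μ ν : Fin (F.P K).d} (hμν : μ < ν) (hμ : (r μ : ℕ) + 1 < (F.P K).L) (hν : (r ν : ℕ) + 1 < (F.P K).L)
include hk hμ hν

/-- The four bonds of the plaquette `⟨blockSite y r, μ, ν⟩` with `r_μ + 1 < L`, `r_ν + 1 < L` are `b₀`-free (all five sites involved lie in `B(y)`). [cite: Balaban1987RG1, p.267 (bookkeeping)] -/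
theorem plaquette_offB0_of_interior (hμν : μ < ν) :
    ¬ IsB0 (F := F) (⟨Site.blockSite y r, μ⟩ : PBond (F.P K) k) ∧ ¬ IsB0 (F := F) (⟨(Site.blockSite y r).shift μ, ν⟩ : PBond (F.P K) k) ∧
      ¬ IsB0 (F := F) (⟨(Site.blockSite y r).shift ν, μ⟩ : PBond (F.P K) k) ∧ ¬ IsB0 (F := F) (⟨Site.blockSite y r, ν⟩ : PBond (F.P K) k) := by
  have hne : μ ≠ ν := ne_of_lt hμν
  have hμ' := shift_blockSite_of_lt y r μ hμ
  have hν' := shift_blockSite_of_lt y r ν hν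
  -- offsets after one step in `μ` (resp. `ν`) still allow one step in `ν` (resp. `μ`)
  have hνμ : ((Function.update r μ ⟨r μ + 1, hμ⟩) ν : ℕ) + 1 < (F.P K).L := by
    rw [Function.update_of_ne hne.symm]; exact hν
  have hμν' : ((Function.update r ν ⟨r ν + 1, hν⟩) μ : ℕ) + 1 < (F.P K).L := by
    rw [Function.update_of_ne hne]; exact hμ
  refine ⟨?_, ?_, ?_, ?_⟩
  · refine not_isB0_of_blockOf_src_eq hk _ ?_
    show blockOf (Site.blockSite y r) = blockOf ((Site.blockSite y r).shift μ)
    rw [hμ', Site.blockOf_blockSite hk, Site.blockOf_blockSite hk]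
  · refine not_isB0_of_blockOf_src_eq hk _ ?_
    show blockOf ((Site.blockSite y r).shift μ) = blockOf (((Site.blockSite y r).shift μ).shift ν)
    rw [hμ', shift_blockSite_of_lt y _ ν hνμ, Site.blockOf_blockSite hk, Site.blockOf_blockSite hk]
  · refine not_isB0_of_blockOf_src_eq hk _ ?_
    show blockOf ((Site.blockSite y r).shift ν) = blockOf (((Site.blockSite y r).shift ν).shift μ)
    rw [hν', shift_blockSite_of_lt y _ μ hμν', Site.blockOf_blockSite hk, Site.blockOf_blockSite hk]
  · refine not_isB0_of_blockOf_src_eq hk _ ?_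
    show blockOf (Site.blockSite y r) = blockOf ((Site.blockSite y r).shift ν)
    rw [hν', Site.blockOf_blockSite hk, Site.blockOf_blockSite hk]

end Interior

/-- The block CENTRE `emb y` is the block site with all offsets `(L − 1)∕2`. [cite: Balaban1987RG1, (0.1) p.252 (bookkeeping)] -/
theorem emb_eq_blockSite (y : Site (F.P K) (k + 1)) :
    emb y = Site.blockSite y (fun _ => ⟨((F.P K).L - 1) / 2, by have := (F.P K).hL.2; omega⟩) := rfl

/-- **THE PLAQUETTE AT A BLOCK CENTRE IS `b₀`-FREE** (`L ≥ 3`, standing range). [cite: Balaban1987RG1, p.267 (bookkeeping)] -/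
theorem plaquette_offB0_centre (hk : k + 1 ≤ (F.P K).m + (F.P K).K) (hL : 3 ≤ (F.P K).L) (y : Site (F.P K) (k + 1)) {μ ν : Fin (F.P K).d} (hμν : μ < ν) :
    ¬ IsB0 (F := F) (⟨emb y, μ⟩ : PBond (F.P K) k) ∧ ¬ IsB0 (F := F) (⟨(emb y).shift μ, ν⟩ : PBond (F.P K) k) ∧
      ¬ IsB0 (F := F) (⟨(emb y).shift ν, μ⟩ : PBond (F.P K) k) ∧ ¬ IsB0 (F := F) (⟨emb y, ν⟩ : PBond (F.P K) k) := by
  rw [emb_eq_blockSite]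
  exact plaquette_offB0_of_interior hk y _ (by simp only; omega) (by simp only; omega) hμν

/-! ## §3 Every group element is a plaquette variable at a `b₀`-free plaquette -/

open Classical in
/-- **THE SINGLE-BOND CONFIGURATION**: `U = g₀` on the bond `⟨p₋, μ⟩` and `1` elsewhere has `U(∂p) = g₀` (sibling of dag-n07's `plaqHol_single_eq`, keyed by bond equality;
`T4WilsonLinkAffine.shift_ne_self` by name). [cite: Balaban1987RG1, (0.2) p.252 (bookkeeping)] -/
theorem plaqHol_singleBond {j : ℕ} (p : Plaq (F.P K) j) (g₀ : SU N) :
    GaugeField.plaqHol (fun b : PBond (F.P K) j => if b = ⟨p.src, p.μ⟩ then g₀ else 1) p = g₀ := by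
  have hne : p.μ ≠ p.ν := ne_of_lt p.hμν
  have h2 : (⟨p.src.shift p.μ, p.ν⟩ : PBond (F.P K) j) ≠ ⟨p.src, p.μ⟩ := fun h => hne.symm (congrArg PBond.dir h)
  have h3 : (⟨p.src.shift p.ν, p.μ⟩ : PBond (F.P K) j) ≠ ⟨p.src, p.μ⟩ := fun h => T4WilsonLinkAffine.shift_ne_self p.src p.ν (congrArg PBond.src h)
  have h4 : (⟨p.src, p.ν⟩ : PBond (F.P K) j) ≠ ⟨p.src, p.μ⟩ := fun h => hne.symm (congrArg PBond.dir h)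
  rw [GaugeField.plaqHol, if_pos rfl, if_neg h2, if_neg h3, if_neg h4, inv_one, mul_one, mul_one, mul_one]

/-- **★ EVERY `g₀ ∈ SU(N)` IS THE PLAQUETTE VARIABLE OF SOME CONFIGURATION AT SOME `b₀`-FREE PLAQUETTE** (`L ≥ 3`, `d ≥ 2`, standing range `k + 1 ≤ m + K`).
[cite: Balaban1987RG1, p.267 and (0.2) p.252 (bookkeeping)] -/
theorem exists_offB0_plaquette_plaqHol_eq (hk : k + 1 ≤ (F.P K).m + (F.P K).K) (hL : 3 ≤ (F.P K).L) (hd : 2 ≤ (F.P K).d) (g₀ : SU N) :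
    ∃ (U : GaugeField (F.P K) k (SU N)) (p : Plaq (F.P K) k),
      ¬ IsB0 (F := F) (⟨p.src, p.μ⟩ : PBond (F.P K) k) ∧ ¬ IsB0 (F := F) (⟨p.src.shift p.μ, p.ν⟩ : PBond (F.P K) k) ∧
      ¬ IsB0 (F := F) (⟨p.src.shift p.ν, p.μ⟩ : PBond (F.P K) k) ∧ ¬ IsB0 (F := F) (⟨p.src, p.ν⟩ : PBond (F.P K) k) ∧
      GaugeField.plaqHol U p = g₀ := by
  classical
  let μ : Fin (F.P K).d := ⟨0, by omega⟩
  let ν : Fin (F.P K).d := ⟨1, by omega⟩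
  have hμν : μ < ν := Fin.mk_lt_mk.2 zero_lt_one
  let p : Plaq (F.P K) k := ⟨emb (default : Site (F.P K) (k + 1)), μ, ν, hμν⟩
  obtain ⟨h₁, h₂, h₃, h₄⟩ := plaquette_offB0_centre (F := F) hk hL (default : Site (F.P K) (k + 1)) hμν
  exact ⟨fun b => if b = ⟨p.src, p.μ⟩ then g₀ else 1, p, h₁, h₂, h₃, h₄, plaqHol_singleBond p g₀⟩

/-- **★ p593634 §3's ANTECEDENT IS INHABITED** as soon as some `g₀ ∈ SU(N)` has `2εreg + 4ε₂₉ ≤ dist1 g₀` (`L ≥ 3`, `d ≥ 2`, standing range): there are `U`, `p` with `p` `b₀`-free and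
`|U(∂p) − 1| ≥ 2εreg + 4ε₂₉` — so `uvLower_densOfRecord₁₃_of_plaquette_off_b0` ∕ `leafL2_on_locus_of_provisos` are NOT vacuous (A6). [cite: Balaban1987RG1, p.267 and (0.2) p.252 (bookkeeping)] -/
theorem exists_offB0_largePlaquette_of_le_dist1 (hk : k + 1 ≤ (F.P K).m + (F.P K).K) (hL : 3 ≤ (F.P K).L) (hd : 2 ≤ (F.P K).d) {c : ℝ} (g₀ : SU N)
    (hg : c ≤ dist1 g₀) :
    ∃ (U : GaugeField (F.P K) k (SU N)) (p : Plaq (F.P K) k),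
      ¬ IsB0 (F := F) (⟨p.src, p.μ⟩ : PBond (F.P K) k) ∧ ¬ IsB0 (F := F) (⟨p.src.shift p.μ, p.ν⟩ : PBond (F.P K) k) ∧
      ¬ IsB0 (F := F) (⟨p.src.shift p.ν, p.μ⟩ : PBond (F.P K) k) ∧ ¬ IsB0 (F := F) (⟨p.src, p.ν⟩ : PBond (F.P K) k) ∧
      c ≤ dist1 (GaugeField.plaqHol U p) := by
  obtain ⟨U, p, h₁, h₂, h₃, h₄, hU⟩ := exists_offB0_plaquette_plaqHol_eq (F := F) hk hL hd g₀
  exact ⟨U, p, h₁, h₂, h₃, h₄, by rw [hU]; exact hg⟩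

/-! ## §4 The group numeral at `N = 2`: `dist1 (−1) = 2` in `SU(2)`, so the locus is inhabited whenever `2εreg + 4ε₂₉ ≤ 2` -/

/-- **`dist1 (−1) = 2` IN `SU(2)`** (the tree's `dist1` = operator-norm distance to `1`, `SU2Mean.dist1_eq_norm`; chord formula `‖1 − U‖² = 2 − Re tr U` with `Re tr(−1) = −2`; `−1 ∈ SU(2)` is the
landed `BrascampLiebVacuumSC.DimensionGapSU2.neg_one_mem`, cited by name).
[cite: Balaban1985Averaging, (19) p.21 (bookkeeping)] -/
theorem dist1_neg_one_SU2 : dist1 (⟨-1, Summit.QuantumFields.YangMills.Theorems.BrascampLiebVacuumSC.DimensionGapSU2.neg_one_mem⟩ : Matrix.specialUnitaryGroup (Fin 2) ℂ) = 2 := by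
  rw [SU2Mean.dist1_eq_norm, norm_sub_rev]
  have h := Literature.Computability.QuantumComplexity.norm_one_sub_coe_sq ⟨-1, Summit.QuantumFields.YangMills.Theorems.BrascampLiebVacuumSC.DimensionGapSU2.neg_one_mem⟩
  have htr : (((⟨-1, Summit.QuantumFields.YangMills.Theorems.BrascampLiebVacuumSC.DimensionGapSU2.neg_one_mem⟩ : Matrix.specialUnitaryGroup (Fin 2) ℂ) : Matrix (Fin 2) (Fin 2) ℂ).trace).re = -2 := by
    show ((-1 : Matrix (Fin 2) (Fin 2) ℂ).trace).re = -2
    simp [Matrix.trace_neg, Matrix.trace_one, Fintype.card_fin]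
  rw [htr] at h
  have hnn : 0 ≤ ‖(1 : Matrix (Fin 2) (Fin 2) ℂ) - ((⟨-1, Summit.QuantumFields.YangMills.Theorems.BrascampLiebVacuumSC.DimensionGapSU2.neg_one_mem⟩ : Matrix.specialUnitaryGroup (Fin 2) ℂ) : Matrix (Fin 2) (Fin 2) ℂ)‖ :=
    norm_nonneg _
  nlinarith

/-- **★ AT `N = 2` THE LARGE-FIELD LOCUS OF p593634 IS INHABITED WHENEVER `c ≤ 2`** (in particular for `c = 2εreg + 4ε₂₉` with the small thresholds of record): `L ≥ 3`, standing range.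
[cite: Balaban1987RG1, p.267 and (0.2) p.252; Balaban1985Averaging, (19) p.21 (bookkeeping)] -/
theorem exists_offB0_largePlaquette_SU2 (hk : k + 1 ≤ (F.P K).m + (F.P K).K) (hL : 3 ≤ (F.P K).L) {c : ℝ} (hc : c ≤ 2) :
    ∃ (U : GaugeField (F.P K) k (SU 2)) (p : Plaq (F.P K) k),
      ¬ IsB0 (F := F) (⟨p.src, p.μ⟩ : PBond (F.P K) k) ∧ ¬ IsB0 (F := F) (⟨p.src.shift p.μ, p.ν⟩ : PBond (F.P K) k) ∧
      ¬ IsB0 (F := F) (⟨p.src.shift p.ν, p.μ⟩ : PBond (F.P K) k) ∧ ¬ IsB0 (F := F) (⟨p.src, p.ν⟩ : PBond (F.P K) k) ∧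
      c ≤ dist1 (GaugeField.plaqHol U p) :=
  exists_offB0_largePlaquette_of_le_dist1 (N := 2) hk hL (by rw [T4Family.P_d]; omega) _ (hc.trans dist1_neg_one_SU2.symm.le)

end Summit.QuantumFields.YangMills.BalabanUVNodes.N13OffB0PlaquetteWitness

end
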